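import Mathlib
import HarnessLib
import Summits.Ventures.LatticeQCDFlow.Scoring.BlockMartingaleSqFutureDecorrelation
import Summits.Ventures.LatticeQCDFlow.Scoring.ChainMartingaleFourthMoment

/-!
# The LEADING CONSTANT of the fourth moment of the block martingale, from any start, under a
# geometric sup-norm envelope: `|E_{μ₀}[M_{s,n}⁴] − 3 (πq)² n²| ≤ K n √n`

HONEST FRAMING: exact (Metropolis-corrected) sampling algorithms for lattice gauge theory;
figures of merit are autocorrelation/cost numbers at stated couplings and volumes; no
continuum-physics claim.

Venture `LatticeQCDFlow` (cell pub-lqcd), topic `Scoring`; FANOUT row 8 (`s0-cpn-nemc`, GEN-21).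
NEW WORK of the cell, not a published result; no definition is introduced; nothing is cited as a
fact.  GEN-19 (`Scoring/ChainMartingaleFourthMoment.lean`) bounded `E[M_{s,n}⁴] ≤ 48 C_h⁴ n²`
(Burkholder-type, any start).  Here the leading constant is identified: with `q = kop κ (h²) − (kop κ h)²`
the conditional variance of the increment and `πq = ∫ q dπ` (`= σ²_f` when `h` solves the Poisson
equation, `Scoring/GeometricEnvelopeBlockSumMoments.poisson_condVar_integral_eq_greenKubo_of_envelope`),
`E_{μ₀}[M_{s,n}⁴] = 3 (πq)² n² + O(n^{3/2})` uniformly in the block position and the initial law.  The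
recursion `E M_{n+1}⁴ = E M_n⁴ + 4 E[M_n³ D_n] + 6 E[M_n² D_n²] + 4 E[M_n D_n³] + E[D_n⁴]` is evaluated
term by term: `E[M_n³ D_n] = 0` (orthogonality); `E[M_n² D_n²] = E[M_n² q(X_{s+n})] = πq · E M_n² + O(1)`
by the decorrelation of the squared martingale from a later centred observable
(`Scoring/BlockMartingaleSqFutureDecorrelation.lean` with `ḡ = q − πq`, `|ḡ| ≤ C_h²`) and
`E M_n² = n πq + O(1)` (`Scoring/GeometricEnvelopeBlockSumMoments.lean`); `|E[M_n D_n³]| ≤ 8 C_h³ E|M_n| ≤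
8 C_h⁴ √n` (Jensen); `E D_n⁴ ≤ 16 C_h⁴`.  Hence `|E M_{n+1}⁴ − E M_n⁴ − 6 (πq)² n| ≤ K₂ + 32 C_h⁴ √n` and,
summing, `|E M_{s,n}⁴ − 3 (πq)² (n² − n)| ≤ n (K₂ + 32 C_h⁴ √n)`.  This is the fourth-moment input of
the leading `2 σ⁴_f/a` VARIANCE of the batch-means estimator (the term that, with the `4 Γ_f²/b²`
squared bias of `Scoring/BatchMeansBiasLeading.lean`, makes `b ∼ N^{1/3}` the mean-square-optimal batch
length).  Printed counterpart NAMED ONLY: the martingale CLT with fourth moments / Burkholder–Rosenthal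
inequalities (Hall–Heyde 1980 Ch. 3), nothing cited as a fact.

## Content (envelope `(A, ρ)`, `0 ≤ A`, `0 ≤ ρ < 1`; `|h| ≤ C_h` measurable; `P_{μ₀}` from ANY `μ₀`;
## `πq = ∫ (kop κ (h²) − (kop κ h)²) dπ`)

* `chain_blockMartingale_abs_le` — `E_{μ₀}|M_{s,n}| ≤ C_h √n`;
* **`abs_chain_blockMartingale_fourth_step_sub_le_of_envelope`** —
  `|E M_{s,n+1}⁴ − E M_{s,n}⁴ − 6 (πq)² n| ≤ K₂ + 32 C_h⁴ √n`,
  `K₂ = 12 C_h⁴ A/(1−ρ) + 6 (8 C_h⁴ A + 32 C_h⁴ A²/(1−ρ))/(1−ρ) + 16 C_h⁴`;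
* **`abs_chain_blockMartingale_fourth_sub_le_of_envelope`** — for all `n`:
  `|E_{μ₀}[M_{s,n}⁴] − 3 (πq)² (n² − n)| ≤ n (K₂ + 32 C_h⁴ √n)`;
* **`abs_chain_blockMartingale_fourth_sub_leading_le_of_envelope`** —
  `|E_{μ₀}[M_{s,n}⁴] − 3 (πq)² n²| ≤ (K₂ + 35 C_h⁴) n √n` (`n ≥ 1`).

NOT CLAIMED: the `O(n)` (rather than `O(n^{3/2})`) remainder, which holds but needs the cubic
conditional moment; unbounded `h`; anything about a concrete sampler.
-/

noncomputable section

namespace Summit.Ventures.LatticeQCDFlow.Scoring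

open MeasureTheory ProbabilityTheory Filter Finset Preorder Literature.Probability.MarkovChains
open scoped ENNReal Topology

variable {Ω : Type*} [MeasurableSpace Ω]

section Jensen

variable (κ : Kernel Ω Ω) [IsMarkovKernel κ] (μ₀ : Measure Ω) [IsProbabilityMeasure μ₀]

/-- **`E_{μ₀}|M_{s,n}| ≤ C_h √n`** (Jensen and `E M_{s,n}² ≤ n C_h²`). -/
theorem chain_blockMartingale_abs_le {h : Ω → ℝ} (hh : Measurable h) {Ch : ℝ}
    (hCh : ∀ x, |h x| ≤ Ch) (s n : ℕ) :
    ∫ x, |∑ t ∈ Finset.range n, (h (x (s + t + 1)) - kop κ h (x (s + t)))|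
        ∂(Kernel.trajMeasure (X := fun _ : ℕ => Ω) μ₀
          (fun n : ℕ => κ.comap (fun h : (i : ↥(Finset.Iic n)) → Ω => h ⟨n, Finset.mem_Iic.2 le_rfl⟩)
            (measurable_pi_apply _)))
      ≤ Ch * Real.sqrt n := by
  set P := Kernel.trajMeasure (X := fun _ : ℕ => Ω) μ₀
      (fun n : ℕ => κ.comap (fun h : (i : ↥(Finset.Iic n)) → Ω => h ⟨n, Finset.mem_Iic.2 le_rfl⟩)
        (measurable_pi_apply _)) with hP
  have hCh0 : 0 ≤ Ch := (abs_nonneg _).trans (hCh (Classical.choice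
    (nonempty_of_isProbabilityMeasure μ₀)))
  set M : (ℕ → Ω) → ℝ := fun x => ∑ t ∈ Finset.range n, (h (x (s + t + 1)) - kop κ h (x (s + t)))
    with hM
  have hMm : Measurable M := blockMartingale_measurable κ hh s n
  have hMb : ∀ x, |M x| ≤ n * (2 * Ch) := fun x => abs_blockMartingale_le κ hCh s n x
  have hAm : Measurable fun x => |M x| := continuous_abs.measurable.comp hMm
  have hAb : ∀ x, |(fun x => |M x|) x| ≤ n * (2 * Ch) := fun x => by
    show |(|M x|)| ≤ n * (2 * Ch); rw [abs_abs]; exact hMb x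
  have hJ := sq_integral_le_integral_sq P hAm hAb
  have hM2 := chain_blockMartingale_sq_le κ μ₀ hh hCh s n
  rw [← hP] at hM2
  have hsq : ∫ x, (fun x => |M x|) x ^ 2 ∂P = ∫ x, M x ^ 2 ∂P :=
    integral_congr_ae (ae_of_all _ fun x => by show |M x| ^ 2 = M x ^ 2; exact sq_abs _)
  rw [hsq] at hJ
  have h0 : 0 ≤ ∫ x, |M x| ∂P := integral_nonneg fun x => abs_nonneg _
  have hle : (∫ x, |M x| ∂P) ^ 2 ≤ (Ch * Real.sqrt n) ^ 2 := by
    calc (∫ x, |M x| ∂P) ^ 2 ≤ ∫ x, M x ^ 2 ∂P := hJ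
      _ ≤ n * Ch ^ 2 := hM2
      _ = (Ch * Real.sqrt n) ^ 2 := by
          rw [mul_pow, Real.sq_sqrt (Nat.cast_nonneg n)]; ring
  calc ∫ x, |M x| ∂P = Real.sqrt ((∫ x, |M x| ∂P) ^ 2) := (Real.sqrt_sq h0).symm
    _ ≤ Real.sqrt ((Ch * Real.sqrt n) ^ 2) := Real.sqrt_le_sqrt hle
    _ = Ch * Real.sqrt n := Real.sqrt_sq (by positivity)

end Jensen

section Envelope

variable {κ : Kernel Ω Ω} [IsMarkovKernel κ] {π : Measure Ω} [IsProbabilityMeasure π] {A ρ : ℝ}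
  (μ₀ : Measure Ω) [IsProbabilityMeasure μ₀]

/-- **ONE STEP OF THE FOURTH-MOMENT RECURSION.**  Envelope `(A, ρ)` (`0 ≤ A`, `0 ≤ ρ < 1`),
`|h| ≤ C_h` measurable, `πq = ∫ (kop κ (h²) − (kop κ h)²) dπ`; for every `μ₀`, `s`, `n`:
`|E M_{s,n+1}⁴ − E M_{s,n}⁴ − 6 (πq)² n| ≤ K₂ + 32 C_h⁴ √n` with
`K₂ = 12 C_h⁴ A/(1−ρ) + 6 (8 C_h⁴ A + 32 C_h⁴ A²/(1−ρ))/(1−ρ) + 16 C_h⁴`. -/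
theorem abs_chain_blockMartingale_fourth_step_sub_le_of_envelope
    (henv : ∀ (g : Ω → ℝ), Measurable g → ∀ (Cg : ℝ), (∀ x, |g x| ≤ Cg) →
      ∀ (t : ℕ) (x : Ω), |(kop κ)^[t] g x - ∫ y, g y ∂π| ≤ 2 * Cg * (A * ρ ^ t))
    (hA : 0 ≤ A) (hρ0 : 0 ≤ ρ) (hρ1 : ρ < 1)
    {h : Ω → ℝ} (hh : Measurable h) {Ch : ℝ} (hCh : ∀ x, |h x| ≤ Ch) (s n : ℕ) :
    |∫ x, (∑ t ∈ Finset.range (n + 1), (h (x (s + t + 1)) - kop κ h (x (s + t)))) ^ 4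
        ∂(Kernel.trajMeasure (X := fun _ : ℕ => Ω) μ₀
          (fun n : ℕ => κ.comap (fun h : (i : ↥(Finset.Iic n)) → Ω => h ⟨n, Finset.mem_Iic.2 le_rfl⟩)
            (measurable_pi_apply _)))
      - ∫ x, (∑ t ∈ Finset.range n, (h (x (s + t + 1)) - kop κ h (x (s + t)))) ^ 4
        ∂(Kernel.trajMeasure (X := fun _ : ℕ => Ω) μ₀
          (fun n : ℕ => κ.comap (fun h : (i : ↥(Finset.Iic n)) → Ω => h ⟨n, Finset.mem_Iic.2 le_rfl⟩)
            (measurable_pi_apply _)))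
      - 6 * (∫ y, (kop κ (fun z => h z ^ 2) y - (kop κ h y) ^ 2) ∂π) ^ 2 * n|
      ≤ 12 * Ch ^ 4 * A / (1 - ρ) + 6 * ((8 * Ch ^ 4 * A + 32 * Ch ^ 4 * A ^ 2 / (1 - ρ)) / (1 - ρ))
        + 16 * Ch ^ 4 + 32 * Ch ^ 4 * Real.sqrt n := by
  set P := Kernel.trajMeasure (X := fun _ : ℕ => Ω) μ₀
      (fun n : ℕ => κ.comap (fun h : (i : ↥(Finset.Iic n)) → Ω => h ⟨n, Finset.mem_Iic.2 le_rfl⟩)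
        (measurable_pi_apply _)) with hP
  have h1ρ : 0 < 1 - ρ := sub_pos.2 hρ1
  have hCh0 : 0 ≤ Ch := (abs_nonneg _).trans (hCh (Classical.choice
    (nonempty_of_isProbabilityMeasure μ₀)))
  -- notation
  set D : ℕ → (ℕ → Ω) → ℝ := fun t x => h (x (s + t + 1)) - kop κ h (x (s + t)) with hD
  set M : (ℕ → Ω) → ℝ := fun x => ∑ t ∈ Finset.range n, D t x with hM
  set q : Ω → ℝ := fun y => kop κ (fun z => h z ^ 2) y - (kop κ h y) ^ 2 with hq
  set mq : ℝ := ∫ y, q y ∂π with hmq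
  obtain ⟨hqm, hqb⟩ := kopCondVar_bounded_measurable κ hh hCh
  have hq0 : ∀ y, 0 ≤ q y := fun y => kopCondVar_nonneg κ hh hCh y
  have hq1 : ∀ y, q y ≤ Ch ^ 2 := fun y => kopCondVar_le κ hCh y
  have hmq0 : 0 ≤ mq := integral_nonneg hq0
  have hmq1 : mq ≤ Ch ^ 2 := by
    calc mq ≤ ∫ y, Ch ^ 2 ∂π := integral_mono (integrable_of_bounded π hqm hqb) (integrable_const _) hq1
      _ = Ch ^ 2 := by rw [integral_const, probReal_univ, one_smul]
  have hmqabs : |mq| ≤ Ch ^ 2 := abs_le.2 ⟨by linarith [sq_nonneg Ch], hmq1⟩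
  -- the centred conditional variance `q̄ = q − πq`, `|q̄| ≤ C_h²`, `π q̄ = 0`
  have hqcm : Measurable fun y => q y - mq := hqm.sub measurable_const
  have hqcb : ∀ y, |q y - mq| ≤ Ch ^ 2 := fun y =>
    abs_le.2 ⟨by linarith [hq0 y, hmq1], by linarith [hq1 y, hmq0]⟩
  have hqc0 : ∫ y, (q y - mq) ∂π = 0 := by
    rw [integral_sub (integrable_of_bounded π hqm hqb) (integrable_const _), integral_const,
      probReal_univ, one_smul, hmq, sub_self]
  have hDm : ∀ t, Measurable (D t) := fun t =>
    (hh.comp (measurable_pi_apply _)).sub ((measurable_kop κ hh).comp (measurable_pi_apply _))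
  have hDb : ∀ t x, |D t x| ≤ 2 * Ch := fun t x =>
    (abs_sub _ _).trans (by linarith [hCh (x (s + t + 1)), abs_kop_le κ hCh (x (s + t))])
  have hMm : Measurable M := Finset.measurable_sum _ fun t _ => hDm t
  have hMb : ∀ x, |M x| ≤ n * (2 * Ch) := fun x => abs_blockMartingale_le κ hCh s n x
  have hMd : DependsOn M (Set.Iic (s + n)) := blockMartingale_dependsOn (kop κ) h s n
  have hB0 : 0 ≤ (n : ℝ) * (2 * Ch) := by positivity
  -- expand `(M + D)^4`
  have hsucc : ∀ x : ℕ → Ω, ∑ t ∈ Finset.range (n + 1), D t x = M x + D n x := fun x => by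
    rw [Finset.sum_range_succ]
  have hexp : ∀ x : ℕ → Ω, (∑ t ∈ Finset.range (n + 1), D t x) ^ 4
      = M x ^ 4 + 4 * (M x ^ 3 * D n x) + 6 * (M x ^ 2 * D n x ^ 2) + 4 * (M x * D n x ^ 3)
        + D n x ^ 4 := fun x => by rw [hsucc x]; ring
  -- integrability (everything is bounded measurable)
  have hpow : ∀ (k : ℕ), Integrable (fun x => M x ^ k * D n x ^ (4 - k)) P := fun k =>
    integrable_of_bounded P ((hMm.pow_const k).mul ((hDm n).pow_const (4 - k)))
      (C := (n * (2 * Ch)) ^ k * (2 * Ch) ^ (4 - k)) fun x => by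
        rw [abs_mul, abs_pow, abs_pow]
        exact mul_le_mul (pow_le_pow_left₀ (abs_nonneg _) (hMb x) k)
          (pow_le_pow_left₀ (abs_nonneg _) (hDb n x) _) (by positivity) (by positivity)
  have hi4 : Integrable (fun x => M x ^ 4) P := by
    have h := hpow 4; simp only [Nat.sub_self, pow_zero, mul_one] at h; exact h
  have hi31 : Integrable (fun x => M x ^ 3 * D n x) P := by
    have h := hpow 3; simpa only [show 4 - 3 = 1 from rfl, pow_one] using h
  have hi22 : Integrable (fun x => M x ^ 2 * D n x ^ 2) P := hpow 2
  have hi13 : Integrable (fun x => M x * D n x ^ 3) P := by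
    have h := hpow 1; simpa only [show 4 - 1 = 3 from rfl, pow_one] using h
  have hi04 : Integrable (fun x => D n x ^ 4) P := by
    have h := hpow 0; simpa only [pow_zero, one_mul] using h
  have hsplit : ∫ x, (∑ t ∈ Finset.range (n + 1), D t x) ^ 4 ∂P
      = ∫ x, M x ^ 4 ∂P + 4 * ∫ x, M x ^ 3 * D n x ∂P + 6 * ∫ x, M x ^ 2 * D n x ^ 2 ∂P
        + 4 * ∫ x, M x * D n x ^ 3 ∂P + ∫ x, D n x ^ 4 ∂P := by
    have hI1 : Integrable (fun x => M x ^ 4 + 4 * (M x ^ 3 * D n x)) P := hi4.add (hi31.const_mul 4)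
    have hI2 : Integrable (fun x => M x ^ 4 + 4 * (M x ^ 3 * D n x) + 6 * (M x ^ 2 * D n x ^ 2)) P :=
      hI1.add (hi22.const_mul 6)
    have hI3 : Integrable (fun x => M x ^ 4 + 4 * (M x ^ 3 * D n x) + 6 * (M x ^ 2 * D n x ^ 2)
        + 4 * (M x * D n x ^ 3)) P := hI2.add (hi13.const_mul 4)
    rw [integral_congr_ae (ae_of_all _ hexp), integral_add hI3 hi04, integral_add hI2 (hi13.const_mul 4),
      integral_add hI1 (hi22.const_mul 6), integral_add hi4 (hi31.const_mul 4), integral_const_mul,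
      integral_const_mul, integral_const_mul]
  -- (a) orthogonality `E[M³ D] = 0`
  have hM3d : DependsOn (fun x => M x ^ 3) (Set.Iic (s + n)) := fun x y hxy => by
    show M x ^ 3 = M y ^ 3; rw [hMd hxy]
  have hM3b : ∀ x, |M x ^ 3| ≤ (n * (2 * Ch)) ^ 3 := fun x => by
    rw [abs_pow]; exact pow_le_pow_left₀ (abs_nonneg _) (hMb x) 3
  have ha : ∫ x, M x ^ 3 * D n x ∂P = 0 := by
    have h := chain_increment_orthogonal κ μ₀ (s + n) (hMm.pow_const 3) hM3d hM3b hh hCh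
    rw [← hP] at h
    exact h
  -- (b) `E[M² D²] = E[M² q(X_{s+n})] = mq E M² + E[M² q̄(X_{s+n})]`
  have hM2d : DependsOn (fun x => M x ^ 2) (Set.Iic (s + n)) := fun x y hxy => by
    show M x ^ 2 = M y ^ 2; rw [hMd hxy]
  have hM2b : ∀ x, |M x ^ 2| ≤ (n * (2 * Ch)) ^ 2 := fun x => by
    rw [abs_pow]; exact pow_le_pow_left₀ (abs_nonneg _) (hMb x) 2
  have hb : ∫ x, M x ^ 2 * D n x ^ 2 ∂P = ∫ x, M x ^ 2 * q (x (s + n)) ∂P := by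
    have h := chain_increment_sq κ μ₀ (s + n) (hMm.pow_const 2) hM2d hM2b hh hCh
    rw [← hP] at h
    exact h
  have hiM2 : Integrable (fun x => M x ^ 2) P := integrable_of_bounded P (hMm.pow_const 2) hM2b
  have hiM2q : Integrable (fun x => M x ^ 2 * (q (x (s + n)) - mq)) P :=
    integrable_of_bounded P ((hMm.pow_const 2).mul (hqcm.comp (measurable_pi_apply _)))
      (C := (n * (2 * Ch)) ^ 2 * Ch ^ 2) fun x => by
        rw [abs_mul]; exact mul_le_mul (hM2b x) (hqcb _) (abs_nonneg _) (by positivity)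
  have hb' : ∫ x, M x ^ 2 * q (x (s + n)) ∂P
      = mq * ∫ x, M x ^ 2 ∂P + ∫ x, M x ^ 2 * (q (x (s + n)) - mq) ∂P := by
    have hpt : ∀ x : ℕ → Ω, M x ^ 2 * q (x (s + n)) = mq * M x ^ 2 + M x ^ 2 * (q (x (s + n)) - mq) :=
      fun x => by ring
    rw [integral_congr_ae (ae_of_all _ hpt), integral_add (hiM2.const_mul mq) hiM2q, integral_const_mul]
  -- `|E[M² q̄(X_{s+n})]| ≤ K_M`
  have hKM : |∫ x, M x ^ 2 * (q (x (s + n)) - mq) ∂P|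
      ≤ (8 * Ch ^ 2 * Ch ^ 2 * A + 32 * Ch ^ 2 * Ch ^ 2 * A ^ 2 / (1 - ρ)) / (1 - ρ) := by
    have h := abs_chain_blockMartingale_sq_mul_future_le_of_envelope μ₀ henv hA hρ0 hρ1 hh hCh hqcm hqcb
      hqc0 s n 0
    rw [← hP] at h
    simp only [Nat.add_zero, pow_zero, mul_one] at h
    exact h
  -- `|E M² − n mq| ≤ 2 C_h² A/(1−ρ)`
  have hM2 : |∫ x, M x ^ 2 ∂P - n * mq| ≤ 2 * Ch ^ 2 * A / (1 - ρ) := by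
    have h := abs_chain_blockMartingale_sq_sub_le_of_envelope henv hA hρ0 hρ1 hh hCh μ₀ s n
    rw [← hP] at h
    exact h
  -- (c) `|E[M D³]| ≤ 8 C_h⁴ √n`
  have hc : |∫ x, M x * D n x ^ 3 ∂P| ≤ 8 * Ch ^ 4 * Real.sqrt n := by
    have hE := chain_blockMartingale_abs_le κ μ₀ hh hCh s n
    rw [← hP] at hE
    have hiB : Integrable (fun x => |M x| * (2 * Ch) ^ 3) P :=
      (integrable_of_bounded P hMm hMb).abs.mul_const _
    calc |∫ x, M x * D n x ^ 3 ∂P| = ‖∫ x, M x * D n x ^ 3 ∂P‖ := (Real.norm_eq_abs _).symm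
      _ ≤ ∫ x, ‖M x * D n x ^ 3‖ ∂P := norm_integral_le_integral_norm _
      _ ≤ ∫ x, |M x| * (2 * Ch) ^ 3 ∂P := by
          refine integral_mono_of_nonneg (ae_of_all _ fun x => norm_nonneg _) hiB
            (ae_of_all _ fun x => ?_)
          show ‖M x * D n x ^ 3‖ ≤ |M x| * (2 * Ch) ^ 3
          rw [Real.norm_eq_abs, abs_mul, abs_pow]
          exact mul_le_mul_of_nonneg_left (pow_le_pow_left₀ (abs_nonneg _) (hDb n x) 3) (abs_nonneg _)
      _ = (∫ x, |M x| ∂P) * (2 * Ch) ^ 3 := integral_mul_const _ _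
      _ ≤ Ch * Real.sqrt n * (2 * Ch) ^ 3 := mul_le_mul_of_nonneg_right hE (by positivity)
      _ = 8 * Ch ^ 4 * Real.sqrt n := by ring
  -- (d) `|E D⁴| ≤ 16 C_h⁴`
  have hd : |∫ x, D n x ^ 4 ∂P| ≤ 16 * Ch ^ 4 := by
    calc |∫ x, D n x ^ 4 ∂P| = ‖∫ x, D n x ^ 4 ∂P‖ := (Real.norm_eq_abs _).symm
      _ ≤ (2 * Ch) ^ 4 * P.real Set.univ := norm_integral_le_of_norm_le_const
          (Eventually.of_forall fun x => by
            rw [Real.norm_eq_abs, abs_pow]; exact pow_le_pow_left₀ (abs_nonneg _) (hDb n x) 4)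
      _ = 16 * Ch ^ 4 := by rw [probReal_univ, mul_one]; ring
  -- assemble
  have halg : ∫ x, (∑ t ∈ Finset.range (n + 1), D t x) ^ 4 ∂P - ∫ x, M x ^ 4 ∂P - 6 * mq ^ 2 * n
      = 6 * (mq * (∫ x, M x ^ 2 ∂P - n * mq) + ∫ x, M x ^ 2 * (q (x (s + n)) - mq) ∂P)
        + 4 * ∫ x, M x * D n x ^ 3 ∂P + ∫ x, D n x ^ 4 ∂P := by
    rw [hsplit, ha, hb, hb']; ring
  rw [halg]
  have h6 : |6 * (mq * (∫ x, M x ^ 2 ∂P - n * mq) + ∫ x, M x ^ 2 * (q (x (s + n)) - mq) ∂P)|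
      ≤ 6 * (Ch ^ 2 * (2 * Ch ^ 2 * A / (1 - ρ))
        + (8 * Ch ^ 2 * Ch ^ 2 * A + 32 * Ch ^ 2 * Ch ^ 2 * A ^ 2 / (1 - ρ)) / (1 - ρ)) := by
    rw [abs_mul, show |(6 : ℝ)| = 6 from abs_of_pos (by norm_num)]
    refine mul_le_mul_of_nonneg_left ((abs_add_le _ _).trans (add_le_add ?_ hKM)) (by norm_num)
    rw [abs_mul]
    exact mul_le_mul hmqabs hM2 (abs_nonneg _) (sq_nonneg _)
  have h4 : |4 * ∫ x, M x * D n x ^ 3 ∂P| ≤ 32 * Ch ^ 4 * Real.sqrt n := by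
    rw [abs_mul, show |(4 : ℝ)| = 4 from abs_of_pos (by norm_num)]
    linarith [hc]
  calc |6 * (mq * (∫ x, M x ^ 2 ∂P - n * mq) + ∫ x, M x ^ 2 * (q (x (s + n)) - mq) ∂P)
        + 4 * ∫ x, M x * D n x ^ 3 ∂P + ∫ x, D n x ^ 4 ∂P|
      ≤ |6 * (mq * (∫ x, M x ^ 2 ∂P - n * mq) + ∫ x, M x ^ 2 * (q (x (s + n)) - mq) ∂P)|
        + |4 * ∫ x, M x * D n x ^ 3 ∂P| + |∫ x, D n x ^ 4 ∂P| :=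
        (abs_add_le _ _).trans (add_le_add (abs_add_le _ _) le_rfl)
    _ ≤ 6 * (Ch ^ 2 * (2 * Ch ^ 2 * A / (1 - ρ))
        + (8 * Ch ^ 2 * Ch ^ 2 * A + 32 * Ch ^ 2 * Ch ^ 2 * A ^ 2 / (1 - ρ)) / (1 - ρ))
        + 32 * Ch ^ 4 * Real.sqrt n + 16 * Ch ^ 4 := add_le_add (add_le_add h6 h4) hd
    _ = 12 * Ch ^ 4 * A / (1 - ρ) + 6 * ((8 * Ch ^ 4 * A + 32 * Ch ^ 4 * A ^ 2 / (1 - ρ)) / (1 - ρ))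
        + 16 * Ch ^ 4 + 32 * Ch ^ 4 * Real.sqrt n := by ring

/-- **THE FOURTH MOMENT OF THE BLOCK MARTINGALE, SUMMED**: for all `n`,
`|E_{μ₀}[M_{s,n}⁴] − 3 (πq)² (n² − n)| ≤ n (K₂ + 32 C_h⁴ √n)`. -/
theorem abs_chain_blockMartingale_fourth_sub_le_of_envelope
    (henv : ∀ (g : Ω → ℝ), Measurable g → ∀ (Cg : ℝ), (∀ x, |g x| ≤ Cg) →
      ∀ (t : ℕ) (x : Ω), |(kop κ)^[t] g x - ∫ y, g y ∂π| ≤ 2 * Cg * (A * ρ ^ t))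
    (hA : 0 ≤ A) (hρ0 : 0 ≤ ρ) (hρ1 : ρ < 1)
    {h : Ω → ℝ} (hh : Measurable h) {Ch : ℝ} (hCh : ∀ x, |h x| ≤ Ch) (s : ℕ) : ∀ n : ℕ,
    |∫ x, (∑ t ∈ Finset.range n, (h (x (s + t + 1)) - kop κ h (x (s + t)))) ^ 4
        ∂(Kernel.trajMeasure (X := fun _ : ℕ => Ω) μ₀
          (fun n : ℕ => κ.comap (fun h : (i : ↥(Finset.Iic n)) → Ω => h ⟨n, Finset.mem_Iic.2 le_rfl⟩)
            (measurable_pi_apply _)))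
      - 3 * (∫ y, (kop κ (fun z => h z ^ 2) y - (kop κ h y) ^ 2) ∂π) ^ 2 * ((n : ℝ) ^ 2 - n)|
      ≤ n * (12 * Ch ^ 4 * A / (1 - ρ) + 6 * ((8 * Ch ^ 4 * A + 32 * Ch ^ 4 * A ^ 2 / (1 - ρ)) / (1 - ρ))
        + 16 * Ch ^ 4 + 32 * Ch ^ 4 * Real.sqrt n)
  | 0 => by simp
  | n + 1 => by
    set P := Kernel.trajMeasure (X := fun _ : ℕ => Ω) μ₀
        (fun n : ℕ => κ.comap (fun h : (i : ↥(Finset.Iic n)) → Ω => h ⟨n, Finset.mem_Iic.2 le_rfl⟩)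
          (measurable_pi_apply _)) with hP
    set mq : ℝ := ∫ y, (kop κ (fun z => h z ^ 2) y - (kop κ h y) ^ 2) ∂π with hmq
    set K2 : ℝ := 12 * Ch ^ 4 * A / (1 - ρ) + 6 * ((8 * Ch ^ 4 * A + 32 * Ch ^ 4 * A ^ 2 / (1 - ρ))
      / (1 - ρ)) + 16 * Ch ^ 4 with hK2
    have h1ρ : 0 < 1 - ρ := sub_pos.2 hρ1
    have hK20 : 0 ≤ K2 := by positivity
    have ih := abs_chain_blockMartingale_fourth_sub_le_of_envelope henv hA hρ0 hρ1 hh hCh s n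
    rw [← hP] at ih
    have hstep := abs_chain_blockMartingale_fourth_step_sub_le_of_envelope μ₀ henv hA hρ0 hρ1 hh hCh s n
    rw [← hP] at hstep
    set X1 := ∫ x, (∑ t ∈ Finset.range (n + 1), (h (x (s + t + 1)) - kop κ h (x (s + t)))) ^ 4 ∂P
      with hX1
    set X0 := ∫ x, (∑ t ∈ Finset.range n, (h (x (s + t + 1)) - kop κ h (x (s + t)))) ^ 4 ∂P
      with hX0
    have hsqrt : Real.sqrt n ≤ Real.sqrt ((n : ℝ) + 1) := Real.sqrt_le_sqrt (by linarith)
    have hn0 : (0 : ℝ) ≤ n := Nat.cast_nonneg n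
    have halg : X1 - 3 * mq ^ 2 * ((((n + 1 : ℕ) : ℝ)) ^ 2 - ((n + 1 : ℕ) : ℝ))
        = (X1 - X0 - 6 * mq ^ 2 * n) + (X0 - 3 * mq ^ 2 * ((n : ℝ) ^ 2 - n)) := by
      push_cast; ring
    rw [halg]
    calc |(X1 - X0 - 6 * mq ^ 2 * n) + (X0 - 3 * mq ^ 2 * ((n : ℝ) ^ 2 - n))|
        ≤ |X1 - X0 - 6 * mq ^ 2 * n| + |X0 - 3 * mq ^ 2 * ((n : ℝ) ^ 2 - n)| := abs_add_le _ _
      _ ≤ (K2 + 32 * Ch ^ 4 * Real.sqrt n) + n * (K2 + 32 * Ch ^ 4 * Real.sqrt n) :=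
          add_le_add hstep ih
      _ = ((n : ℝ) + 1) * (K2 + 32 * Ch ^ 4 * Real.sqrt n) := by ring
      _ ≤ ((n + 1 : ℕ) : ℝ) * (K2 + 32 * Ch ^ 4 * Real.sqrt ((n + 1 : ℕ) : ℝ)) := by
          push_cast
          exact mul_le_mul_of_nonneg_left
            (add_le_add le_rfl (mul_le_mul_of_nonneg_left hsqrt (by positivity))) (by linarith)

/-- **THE LEADING CONSTANT OF `E M⁴`.**  For `n ≥ 1`:
`|E_{μ₀}[M_{s,n}⁴] − 3 (πq)² n²| ≤ (K₂ + 35 C_h⁴) n √n`. -/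
theorem abs_chain_blockMartingale_fourth_sub_leading_le_of_envelope
    (henv : ∀ (g : Ω → ℝ), Measurable g → ∀ (Cg : ℝ), (∀ x, |g x| ≤ Cg) →
      ∀ (t : ℕ) (x : Ω), |(kop κ)^[t] g x - ∫ y, g y ∂π| ≤ 2 * Cg * (A * ρ ^ t))
    (hA : 0 ≤ A) (hρ0 : 0 ≤ ρ) (hρ1 : ρ < 1)
    {h : Ω → ℝ} (hh : Measurable h) {Ch : ℝ} (hCh : ∀ x, |h x| ≤ Ch) (s : ℕ) {n : ℕ} (hn : n ≠ 0) :
    |∫ x, (∑ t ∈ Finset.range n, (h (x (s + t + 1)) - kop κ h (x (s + t)))) ^ 4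
        ∂(Kernel.trajMeasure (X := fun _ : ℕ => Ω) μ₀
          (fun n : ℕ => κ.comap (fun h : (i : ↥(Finset.Iic n)) → Ω => h ⟨n, Finset.mem_Iic.2 le_rfl⟩)
            (measurable_pi_apply _)))
      - 3 * (∫ y, (kop κ (fun z => h z ^ 2) y - (kop κ h y) ^ 2) ∂π) ^ 2 * (n : ℝ) ^ 2|
      ≤ (12 * Ch ^ 4 * A / (1 - ρ) + 6 * ((8 * Ch ^ 4 * A + 32 * Ch ^ 4 * A ^ 2 / (1 - ρ)) / (1 - ρ))
          + 16 * Ch ^ 4 + 35 * Ch ^ 4) * (n * Real.sqrt n) := by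
  set P := Kernel.trajMeasure (X := fun _ : ℕ => Ω) μ₀
      (fun n : ℕ => κ.comap (fun h : (i : ↥(Finset.Iic n)) → Ω => h ⟨n, Finset.mem_Iic.2 le_rfl⟩)
        (measurable_pi_apply _)) with hP
  set mq : ℝ := ∫ y, (kop κ (fun z => h z ^ 2) y - (kop κ h y) ^ 2) ∂π with hmq
  set K2 : ℝ := 12 * Ch ^ 4 * A / (1 - ρ) + 6 * ((8 * Ch ^ 4 * A + 32 * Ch ^ 4 * A ^ 2 / (1 - ρ))
    / (1 - ρ)) + 16 * Ch ^ 4 with hK2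
  have h1ρ : 0 < 1 - ρ := sub_pos.2 hρ1
  have hCh0 : 0 ≤ Ch := (abs_nonneg _).trans (hCh (Classical.choice
    (nonempty_of_isProbabilityMeasure μ₀)))
  have hK20 : 0 ≤ K2 := by positivity
  have hmain := abs_chain_blockMartingale_fourth_sub_le_of_envelope μ₀ henv hA hρ0 hρ1 hh hCh s n
  rw [← hP] at hmain
  set X := ∫ x, (∑ t ∈ Finset.range n, (h (x (s + t + 1)) - kop κ h (x (s + t)))) ^ 4 ∂P with hX
  -- `|mq| ≤ C_h²`
  obtain ⟨hqm, hqb⟩ := kopCondVar_bounded_measurable κ hh hCh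
  have hmq1 : |mq| ≤ Ch ^ 2 := by
    calc |mq| = ‖∫ y, (kop κ (fun z => h z ^ 2) y - (kop κ h y) ^ 2) ∂π‖ := (Real.norm_eq_abs _).symm
      _ ≤ Ch ^ 2 * π.real Set.univ := norm_integral_le_of_norm_le_const (Eventually.of_forall fun y => by
          rw [Real.norm_eq_abs]; exact hqb y)
      _ = Ch ^ 2 := by rw [probReal_univ, mul_one]
  have hmq2 : mq ^ 2 ≤ Ch ^ 4 := by
    have := pow_le_pow_left₀ (abs_nonneg _) hmq1 2
    rw [sq_abs] at this
    calc mq ^ 2 ≤ (Ch ^ 2) ^ 2 := this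
      _ = Ch ^ 4 := by ring
  have hn1 : (1 : ℝ) ≤ n := Nat.one_le_cast.2 (Nat.pos_of_ne_zero hn)
  have hn0 : (0 : ℝ) ≤ n := by linarith
  have hs1 : 1 ≤ Real.sqrt n := by rw [← Real.sqrt_one]; exact Real.sqrt_le_sqrt hn1
  have hns : (n : ℝ) ≤ n * Real.sqrt n := le_mul_of_one_le_right hn0 hs1
  have halg : X - 3 * mq ^ 2 * (n : ℝ) ^ 2 = (X - 3 * mq ^ 2 * ((n : ℝ) ^ 2 - n)) - 3 * mq ^ 2 * n := by
    ring
  rw [halg]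
  calc |(X - 3 * mq ^ 2 * ((n : ℝ) ^ 2 - n)) - 3 * mq ^ 2 * n|
      ≤ |X - 3 * mq ^ 2 * ((n : ℝ) ^ 2 - n)| + |3 * mq ^ 2 * n| := abs_sub _ _
    _ ≤ n * (K2 + 32 * Ch ^ 4 * Real.sqrt n) + 3 * Ch ^ 4 * n := by
        refine add_le_add hmain ?_
        rw [abs_of_nonneg (by positivity)]
        exact mul_le_mul_of_nonneg_right (mul_le_mul_of_nonneg_left hmq2 (by norm_num)) hn0
    _ = K2 * n + 3 * Ch ^ 4 * n + 32 * Ch ^ 4 * (n * Real.sqrt n) := by ring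
    _ ≤ K2 * (n * Real.sqrt n) + 3 * Ch ^ 4 * (n * Real.sqrt n) + 32 * Ch ^ 4 * (n * Real.sqrt n) :=
        add_le_add (add_le_add (mul_le_mul_of_nonneg_left hns hK20)
          (mul_le_mul_of_nonneg_left hns (by positivity))) le_rfl
    _ = (K2 + 35 * Ch ^ 4) * (n * Real.sqrt n) := by ring

end Envelope

end Summit.Ventures.LatticeQCDFlow.Scoring

end
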